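import Summits.CriticalPhenomena.PercolationContinuityZ3.Theorems.SahiAEVersionTransport
import Summits.CriticalPhenomena.PercolationContinuityZ3.Theorems.SahiAEVersionTransportPIT
import Summits.CriticalPhenomena.PercolationContinuityZ3.Theorems.SahiAECornerEnvelopePrelim

/-!
# Transport of Borel everywhere-MTP₂ versions to products of ARBITRARY σ-finite measures (atoms allowed)

Support file of the Sahi cell (`prim-sahi`, typer seat, generation 21; `--supports stmt-CriticalPhenomena-4575`).
Theorems only (no definitions, no named facts, no sorries).

`SahiAEVersionTransport.lean` transports the Borel-version property (`HasBorelMTP2Versions`) from Lebesgue measure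
to products of ATOMLESS measures, descending a version along the (then a.e. invertible) quantile map.  With atoms the
quantile map `Q^⊗ : (0,1)^ι → ℝ^ι` collapses the jump intervals and is not invertible.  The descent used here instead:
for a version `F'` on the cube and `x ∈ ℝ^ι`, let `θ_x(v) = (Φᵢ(xᵢ−) + vᵢ (Φᵢ(xᵢ) − Φᵢ(xᵢ−)))ᵢ` (`rpit`, the
randomized probability integral transform: `v ∈ (0,1)^ι` sweeps the product of the jump intervals of the coordinates
of `x`, a single point when `x` has no atomic coordinate) and put

  `F(x) := ess sup_{v ∈ (0,1)^ι} F'(θ_x(v))`.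

* MTP₂ at EVERY pair: `θ_x(u) ∧ θ_y(v) = θ_{x∧y}(S.piecewise u v)` for the coordinate set `S` where `xᵢ < yᵢ`, or
  `xᵢ = yᵢ` and `uᵢ ≤ vᵢ` (jump intervals of distinct points are ordered; on a common atom the transform is monotone in
  the randomization), likewise for the join; each gluing `S.piecewise u v` of two independent uniform points avoids
  Lebesgue-null sets (`volume_prod_piecewise_mem_null`), so the positive-measure level sets below the two essential
  suprema contain a pair whose glued meet/join respect the essential suprema at `x ∧ y`, `x ∨ y`.
* `F = f` a.e.: `(u, v) ↦ θ_{Q u}(v)` is quasi-measure-preserving for `λ_cube ⊗ λ_cube → λ_cube`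
  (`quasiMeasurePreserving_rpit_rqe` coordinatewise) and `Q(θ_{Q u}(v)) = Q u`; so `F'(θ_{Q u} v) = f(Q u)` for a.e.
  `(u, v)`, and by Fubini the essential supremum over `v` is `f(Q u)` for a.e. `u`.
* Borel: level sets of a parametric essential supremum are measurable by Fubini.

Results: `HasBorelMTP2Versions.pi_of_restrict_openUnitCube'` (every finite product of probability measures on `ℝ`),
`HasBorelMTP2Versions.pi_of_volume'` (every finite product of σ-finite measures on `ℝ`),
`exists_measurable_mtp2_version_of_ae_pi_of_volume'` (unfolded).  No sorries, no new axioms.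
-/

noncomputable section

namespace Summit.CriticalPhenomena.PercolationContinuityZ3.Theorems.SahiAEFourFunctions

open MeasureTheory Set Filter Topology ProbabilityTheory RealQuantile Function
open scoped ENNReal NNReal

/-! ### Finite products of absolutely continuous measures (plumbing, as in `SahiAEVersionTransport`) -/

section PiAC

variable {γ δ : Type*} [MeasurableSpace γ] [MeasurableSpace δ]

/-- `Fin n`-indexed products of absolutely continuous σ-finite measures are absolutely continuous. [folklore]
(adapted from `Literature/MathematicalPhysics/QuantumFieldTheory/Balaban1983to89/T4TriangularPushforward.lean`) -/
private theorem pi_absolutelyContinuous_pi_fin' {n : ℕ} {μ ν : Fin n → Measure γ} [∀ i, SigmaFinite (μ i)]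
    [∀ i, SigmaFinite (ν i)] (h : ∀ i, ν i ≪ μ i) : Measure.pi ν ≪ Measure.pi μ := by
  induction n with
  | zero =>
      rw [Measure.pi_of_empty μ, Measure.pi_of_empty ν]
  | succ n ih =>
      have hμ := measurePreserving_piFinSuccAbove μ 0
      have hν := measurePreserving_piFinSuccAbove ν 0
      have ih' : Measure.pi (fun j => ν (Fin.succAbove 0 j)) ≪ Measure.pi (fun j => μ (Fin.succAbove 0 j)) :=
        ih (fun j => h _)
      have hprod : (ν 0).prod (Measure.pi fun j => ν (Fin.succAbove 0 j)) ≪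
          (μ 0).prod (Measure.pi fun j => μ (Fin.succAbove 0 j)) := (h 0).prod ih'
      have := hprod.map (MeasurableEquiv.piFinSuccAbove (fun _ : Fin (n+1) => γ) 0).symm.measurable
      rwa [(hν.symm _).map_eq, (hμ.symm _).map_eq] at this

/-- Finite products of absolutely continuous σ-finite measures are absolutely continuous. [folklore] -/
private theorem pi_absolutelyContinuous_pi' {ι : Type*} [Fintype ι] {μ ν : ι → Measure γ}
    [∀ i, SigmaFinite (μ i)] [∀ i, SigmaFinite (ν i)] (h : ∀ i, ν i ≪ μ i) : Measure.pi ν ≪ Measure.pi μ := by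
  set e := (Fintype.equivFin ι).symm with he
  have hμ := measurePreserving_piCongrLeft μ e
  have hν := measurePreserving_piCongrLeft ν e
  have hfin : Measure.pi (fun i' => ν (e i')) ≪ Measure.pi (fun i' => μ (e i')) :=
    pi_absolutelyContinuous_pi_fin' (fun i' => h _)
  have := hfin.map (MeasurableEquiv.piCongrLeft (fun _ : ι => γ) e).measurable
  rwa [hν.map_eq, hμ.map_eq] at this

/-- A coordinatewise map of quasi-measure-preserving maps is quasi-measure-preserving for the product measures.
[folklore] -/
theorem quasiMeasurePreserving_pi_map {ι : Type*} [Fintype ι] {σ : ι → Measure γ} {τ : ι → Measure δ}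
    [∀ i, IsFiniteMeasure (σ i)] [∀ i, SigmaFinite (τ i)] {k : ι → γ → δ}
    (hk : ∀ i, Measure.QuasiMeasurePreserving (k i) (σ i) (τ i)) :
    Measure.QuasiMeasurePreserving (fun w i => k i (w i)) (Measure.pi σ) (Measure.pi τ) := by
  have hmeas : Measurable fun (w : ι → γ) i => k i (w i) :=
    measurable_pi_iff.2 fun i => (hk i).measurable.comp (measurable_pi_apply i)
  refine ⟨hmeas, ?_⟩
  haveI : ∀ i, SigmaFinite ((σ i).map (k i)) := fun i => by infer_instance
  rw [Measure.pi_map_pi fun i => (hk i).measurable.aemeasurable]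
  exact pi_absolutelyContinuous_pi' fun i => (hk i).absolutelyContinuous

end PiAC

/-! ### The descent along the randomized probability integral transform -/

section Atoms

variable {ι : Type*} [Fintype ι]

omit [Fintype ι] in
/-- The lattice identity for the coordinatewise transform: the meet of `θ_x(u)` and `θ_y(v)` is `θ_{x∧y}` of a
coordinate gluing of `u` and `v` (`u, v` in the closed unit cube). [this work] -/
theorem rpit_pi_inf [DecidableEq ι] (ν : ι → Measure ℝ) (x y : ι → ℝ) {u v : ι → ℝ} (hu : ∀ i, u i ∈ Icc (0 : ℝ) 1)
    (hv : ∀ i, v i ∈ Icc (0 : ℝ) 1) (S : Finset ι)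
    (hS : ∀ i, i ∈ S ↔ x i < y i ∨ (x i = y i ∧ u i ≤ v i)) :
    (fun i => rpit (ν i) (x i) (u i)) ⊓ (fun i => rpit (ν i) (y i) (v i)) =
      fun i => rpit (ν i) ((x ⊓ y) i) (S.piecewise u v i) := by
  funext i
  simp only [Pi.inf_apply]
  rcases lt_trichotomy (x i) (y i) with hlt | heq | hgt
  · have hi : i ∈ S := (hS i).2 (Or.inl hlt)
    rw [Finset.piecewise_eq_of_mem _ _ _ hi, inf_eq_left.2 hlt.le,
      inf_eq_left.2 (rpit_le_rpit_of_lt (ν i) hlt (hu i) (hv i))]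
  · rw [heq, inf_idem, ← (rpit_mono_right (ν i) (y i)).map_inf (u i) (v i)]
    by_cases hle : u i ≤ v i
    · rw [Finset.piecewise_eq_of_mem _ _ _ ((hS i).2 (Or.inr ⟨heq, hle⟩)), inf_eq_left.2 hle]
    · have hi : i ∉ S := fun h => ((hS i).1 h).elim (fun h' => (lt_irrefl _) (heq ▸ h')) fun h' => hle h'.2
      rw [Finset.piecewise_eq_of_notMem _ _ _ hi, inf_eq_right.2 (not_le.1 hle).le]
  · have hi : i ∉ S := fun h => ((hS i).1 h).elim (fun h' => lt_asymm hgt h') fun h' => (lt_irrefl _) (h'.1 ▸ hgt)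
    rw [Finset.piecewise_eq_of_notMem _ _ _ hi, inf_eq_right.2 hgt.le,
      inf_eq_right.2 (rpit_le_rpit_of_lt (ν i) hgt (hv i) (hu i))]

omit [Fintype ι] in
/-- The join twin of `rpit_pi_inf`. [this work] -/
theorem rpit_pi_sup [DecidableEq ι] (ν : ι → Measure ℝ) (x y : ι → ℝ) {u v : ι → ℝ} (hu : ∀ i, u i ∈ Icc (0 : ℝ) 1)
    (hv : ∀ i, v i ∈ Icc (0 : ℝ) 1) (S : Finset ι)
    (hS : ∀ i, i ∈ S ↔ y i < x i ∨ (x i = y i ∧ v i ≤ u i)) :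
    (fun i => rpit (ν i) (x i) (u i)) ⊔ (fun i => rpit (ν i) (y i) (v i)) =
      fun i => rpit (ν i) ((x ⊔ y) i) (S.piecewise u v i) := by
  funext i
  simp only [Pi.sup_apply]
  rcases lt_trichotomy (x i) (y i) with hlt | heq | hgt
  · have hi : i ∉ S := fun h => ((hS i).1 h).elim (fun h' => lt_asymm hlt h') fun h' => (lt_irrefl _) (h'.1 ▸ hlt)
    rw [Finset.piecewise_eq_of_notMem _ _ _ hi, sup_eq_right.2 hlt.le,
      sup_eq_right.2 (rpit_le_rpit_of_lt (ν i) hlt (hu i) (hv i))]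
  · rw [heq, sup_idem, ← (rpit_mono_right (ν i) (y i)).map_sup (u i) (v i)]
    by_cases hle : v i ≤ u i
    · rw [Finset.piecewise_eq_of_mem _ _ _ ((hS i).2 (Or.inr ⟨heq, hle⟩)), sup_eq_left.2 hle]
    · have hi : i ∉ S := fun h => ((hS i).1 h).elim (fun h' => (lt_irrefl _) (heq ▸ h')) fun h' => hle h'.2
      rw [Finset.piecewise_eq_of_notMem _ _ _ hi, sup_eq_right.2 (not_le.1 hle).le]
  · have hi : i ∈ S := (hS i).2 (Or.inl hgt)
    rw [Finset.piecewise_eq_of_mem _ _ _ hi, sup_eq_left.2 hgt.le,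
      sup_eq_left.2 (rpit_le_rpit_of_lt (ν i) hgt (hv i) (hu i))]

/-- **Lebesgue on the open unit cube ⟹ every finite product of probability measures on `ℝ` (atoms allowed).**
[this work] -/
theorem HasBorelMTP2Versions.pi_of_restrict_openUnitCube'
    (hP : HasBorelMTP2Versions ((volume : Measure (ι → ℝ)).restrict (Set.pi univ fun _ => Ioo (0 : ℝ) 1)))
    (ν : ι → Measure ℝ) [∀ i, IsProbabilityMeasure (ν i)] : HasBorelMTP2Versions (Measure.pi ν) := by
  classical
  intro f hf c M hc hM hcf hfM hMTP
  set U : Set (ι → ℝ) := Set.pi univ fun _ => Ioo (0 : ℝ) 1 with hU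
  have mU : MeasurableSet U := MeasurableSet.univ_pi fun _ => measurableSet_Ioo
  set μ₁ : Measure (ι → ℝ) := (volume : Measure (ι → ℝ)).restrict U with hμ₁
  have hμ₁pi : μ₁ = Measure.pi fun _ : ι => (volume : Measure ℝ).restrict (Ioo (0 : ℝ) 1) := by
    rw [hμ₁, hU, volume_pi, Measure.restrict_pi_pi]
  have hμ₁0 : μ₁ ≠ 0 := by
    intro h
    have h1 : μ₁ U = 0 := by rw [h]; rfl
    rw [hμ₁, Measure.restrict_apply_self, hU, volume_pi_pi] at h1
    simp only [Real.volume_Ioo, sub_zero, ENNReal.ofReal_one, Finset.prod_const_one, one_ne_zero] at h1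
  haveI : IsFiniteMeasure μ₁ := by
    refine ⟨?_⟩
    rw [hμ₁, Measure.restrict_apply_univ, hU, volume_pi_pi]
    simp only [Real.volume_Ioo, sub_zero, ENNReal.ofReal_one, Finset.prod_const_one, ENNReal.one_lt_top]
  -- the quantile map and the pulled-back density
  set T : (ι → ℝ) → (ι → ℝ) := fun u i => rqe (ν i) (u i) with hT
  have hTmp : MeasurePreserving T μ₁ (Measure.pi ν) := by
    rw [hμ₁pi]; exact measurePreserving_pi _ _ fun i => measurePreserving_rqe (ν i)
  have haeU : ∀ᵐ u ∂μ₁, u ∈ U := ae_restrict_mem mU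
  have haeU2 : ∀ᵐ p ∂μ₁.prod μ₁, p.1 ∈ U ∧ p.2 ∈ U := by
    filter_upwards [(Measure.quasiMeasurePreserving_fst (μ := μ₁) (ν := μ₁)).ae haeU,
      (Measure.quasiMeasurePreserving_snd (μ := μ₁) (ν := μ₁)).ae haeU] with p h1 h2 using ⟨h1, h2⟩
  have hTlat : ∀ᵐ p ∂μ₁.prod μ₁, T (p.1 ⊓ p.2) = T p.1 ⊓ T p.2 ∧ T (p.1 ⊔ p.2) = T p.1 ⊔ T p.2 := by
    filter_upwards [haeU2] with p hp
    refine ⟨funext fun i => ?_, funext fun i => ?_⟩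
    · exact (monotoneOn_rqe (ν i)).map_inf (Set.mem_univ_pi.1 hp.1 i) (Set.mem_univ_pi.1 hp.2 i)
    · exact (monotoneOn_rqe (ν i)).map_sup (Set.mem_univ_pi.1 hp.1 i) (Set.mem_univ_pi.1 hp.2 i)
  have hqmp2 : Measure.QuasiMeasurePreserving (Prod.map T T) (μ₁.prod μ₁) ((Measure.pi ν).prod (Measure.pi ν)) :=
    MeasureTheory.QuasiMeasurePreserving.prodMap hTmp.quasiMeasurePreserving hTmp.quasiMeasurePreserving
  have hMTP' : ∀ᵐ p ∂μ₁.prod μ₁, f (T p.1) * f (T p.2) ≤ f (T (p.1 ⊓ p.2)) * f (T (p.1 ⊔ p.2)) := by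
    filter_upwards [hqmp2.ae hMTP, hTlat] with p hp hl
    rw [hl.1, hl.2]; exact hp
  obtain ⟨F', hF'm, ⟨M', hM', hF'M'⟩, hF'ae, hF'mtp⟩ :=
    hP (f ∘ T) (hf.comp hTmp.measurable) c M hc hM (fun x => hcf (T x)) (fun x => hfM (T x)) hMTP'
  -- the transform and the descended version
  set θ : (ι → ℝ) → (ι → ℝ) → (ι → ℝ) := fun x v i => rpit (ν i) (x i) (v i) with hθ
  have hθm : Measurable fun q : (ι → ℝ) × (ι → ℝ) => θ q.1 q.2 := by
    refine measurable_pi_iff.2 fun i => ?_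
    have hq : Measurable fun q : (ι → ℝ) × (ι → ℝ) => ((q.1 i, q.2 i) : ℝ × ℝ) :=
      ((measurable_pi_apply i).comp measurable_fst).prodMk ((measurable_pi_apply i).comp measurable_snd)
    show Measurable fun q : (ι → ℝ) × (ι → ℝ) => rpit (ν i) (q.1 i) (q.2 i)
    exact (measurable_rpit (ν i)).comp hq
  have hθm' : ∀ x, Measurable (θ x) := fun x => hθm.comp (measurable_const.prodMk measurable_id)
  set F : (ι → ℝ) → ℝ≥0∞ := fun x => essSup (fun v => F' (θ x v)) μ₁ with hF
  have hGm : Measurable fun q : (ι → ℝ) × (ι → ℝ) => F' (θ q.1 q.2) := hF'm.comp hθm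
  have hFm : Measurable F := by
    refine measurable_of_Iic fun a => ?_
    have hSm : MeasurableSet {q : (ι → ℝ) × (ι → ℝ) | a < F' (θ q.1 q.2) ∧ q.2 ∈ U} :=
      (measurableSet_lt measurable_const hGm).inter (mU.preimage measurable_snd)
    have hm : Measurable fun x : ι → ℝ =>
        volume (Prod.mk x ⁻¹' {q : (ι → ℝ) × (ι → ℝ) | a < F' (θ q.1 q.2) ∧ q.2 ∈ U}) :=
      measurable_measure_prodMk_left hSm
    have hset : F ⁻¹' Iic a = (fun x : ι → ℝ =>
        volume (Prod.mk x ⁻¹' {q : (ι → ℝ) × (ι → ℝ) | a < F' (θ q.1 q.2) ∧ q.2 ∈ U})) ⁻¹' {0} := by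
      ext x
      simp only [mem_preimage, mem_Iic, mem_singleton_iff]
      have e : Prod.mk x ⁻¹' {q : (ι → ℝ) × (ι → ℝ) | a < F' (θ q.1 q.2) ∧ q.2 ∈ U} =
          {v | a < F' (θ x v)} ∩ U := rfl
      rw [e]
      exact ⟨measure_inter_eq_zero_of_essSup_restrict_le (hF'm.comp (hθm' x)),
        essSup_restrict_le_of_measure_inter_eq_zero (hF'm.comp (hθm' x))⟩
    rw [hset]
    exact hm (measurableSet_singleton 0)
  refine ⟨F, hFm, ⟨M', hM', fun x => essSup_le_of_ae_le _ (Eventually.of_forall fun v => hF'M' _)⟩, ?_, ?_⟩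
  · -- `F = f` almost everywhere
    set κ : (ι → ℝ) × (ι → ℝ) → (ι → ℝ) := fun q => θ (T q.1) q.2 with hκ
    have hκqmp : Measure.QuasiMeasurePreserving κ (μ₁.prod μ₁) μ₁ := by
      have he := (measurePreserving_arrowProdEquivProdArrow ℝ ℝ ι
        (fun _ : ι => (volume : Measure ℝ).restrict (Ioo (0 : ℝ) 1))
        (fun _ : ι => (volume : Measure ℝ).restrict (Ioo (0 : ℝ) 1))).symm
      rw [← hμ₁pi] at he
      have hK : Measure.QuasiMeasurePreserving
          (fun (w : ι → ℝ × ℝ) i => rpit (ν i) (rqe (ν i) (w i).1) (w i).2)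
          (Measure.pi fun _ : ι => ((volume : Measure ℝ).restrict (Ioo (0 : ℝ) 1)).prod
            ((volume : Measure ℝ).restrict (Ioo (0 : ℝ) 1))) μ₁ := by
        rw [hμ₁pi]
        exact quasiMeasurePreserving_pi_map
          (k := fun i (z : ℝ × ℝ) => rpit (ν i) (rqe (ν i) z.1) z.2)
          fun i => quasiMeasurePreserving_rpit_rqe (ν i)
      have hcomp : κ = (fun (w : ι → ℝ × ℝ) i => rpit (ν i) (rqe (ν i) (w i).1) (w i).2) ∘
          (MeasurableEquiv.arrowProdEquivProdArrow ℝ ℝ ι).symm := by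
        funext q; rfl
      rw [hcomp]
      exact hK.comp he.quasiMeasurePreserving
    have h1 : ∀ᵐ q ∂μ₁.prod μ₁, F' (κ q) = f (T (κ q)) := hκqmp.ae hF'ae
    have h2 : ∀ᵐ q ∂μ₁.prod μ₁, T (κ q) = T q.1 := by
      filter_upwards [haeU2] with q hq
      funext i
      have hu := Set.mem_univ_pi.1 hq.1 i
      have hv := Set.mem_univ_pi.1 hq.2 i
      have h := rq_rpit_rq (ν i) hu hv
      show rqe (ν i) (rpit (ν i) (rqe (ν i) (q.1 i)) (q.2 i)) = rqe (ν i) (q.1 i)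
      rw [rqe_of_mem _ hu, rqe_of_mem _ h.1, h.2]
    have h3' : ∀ᵐ q ∂μ₁.prod μ₁, F' (κ q) = f (T q.1) := by
      filter_upwards [h1, h2] with q hq1 hq2
      rw [hq2] at hq1; exact hq1
    have h3 : ∀ᵐ u ∂μ₁, ∀ᵐ v ∂μ₁, F' (θ (T u) v) = f (T u) :=
      Measure.ae_ae_of_ae_prod (p := fun q : (ι → ℝ) × (ι → ℝ) => F' (θ (T q.1) q.2) = f (T q.1)) h3'
    have h4 : ∀ᵐ u ∂μ₁, F (T u) = f (T u) := by
      filter_upwards [h3] with u hu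
      show essSup (fun v => F' (θ (T u) v)) μ₁ = f (T u)
      rw [essSup_congr_ae (hu : (fun v => F' (θ (T u) v)) =ᵐ[μ₁] fun _ => f (T u)), essSup_const _ hμ₁0]
    rw [← hTmp.map_eq]
    exact (ae_map_iff hTmp.measurable.aemeasurable (measurableSet_eq_fun hFm hf)).2 h4
  · -- MTP₂ at every pair
    intro x y
    refine ENNReal.mul_le_of_forall_lt fun a ha b hb => ?_
    set A := {u | a < F' (θ x u)} with hA
    set B := {v | b < F' (θ y v)} with hB
    have hA0 : μ₁ A ≠ 0 := measure_ne_zero_of_lt_essSup' ha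
    have hB0 : μ₁ B ≠ 0 := measure_ne_zero_of_lt_essSup' hb
    have hAB : (μ₁.prod μ₁) (A ×ˢ B) ≠ 0 := by rw [Measure.prod_prod]; exact mul_ne_zero hA0 hB0
    -- the null sets above the essential suprema at the meet and the join
    set N₃ := {w | F (x ⊓ y) < F' (θ (x ⊓ y) w)} ∩ U with hN₃
    set N₄ := {w | F (x ⊔ y) < F' (θ (x ⊔ y) w)} ∩ U with hN₄
    have hN₃0 : volume N₃ = 0 := measure_inter_eq_zero_of_essSup_restrict_le (hF'm.comp (hθm' _)) le_rfl
    have hN₄0 : volume N₄ = 0 := measure_inter_eq_zero_of_essSup_restrict_le (hF'm.comp (hθm' _)) le_rfl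
    have hprod : μ₁.prod μ₁ = ((volume : Measure (ι → ℝ)).prod volume).restrict (U ×ˢ U) := by
      rw [hμ₁, Measure.prod_restrict]
    have good : ∀ᵐ z ∂μ₁.prod μ₁, (z.1 ∈ U ∧ z.2 ∈ U) ∧
        ∀ S : Finset ι, S.piecewise z.1 z.2 ∉ N₃ ∧ S.piecewise z.1 z.2 ∉ N₄ := by
      refine haeU2.and ?_
      rw [ae_all_iff]
      intro S
      have h3 : ∀ᵐ z ∂(volume : Measure (ι → ℝ)).prod volume, S.piecewise z.1 z.2 ∉ N₃ := by
        rw [ae_iff]; simpa only [not_not] using volume_prod_piecewise_mem_null S hN₃0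
      have h4 : ∀ᵐ z ∂(volume : Measure (ι → ℝ)).prod volume, S.piecewise z.1 z.2 ∉ N₄ := by
        rw [ae_iff]; simpa only [not_not] using volume_prod_piecewise_mem_null S hN₄0
      rw [hprod]
      exact ae_restrict_of_ae (h3.and h4)
    obtain ⟨z, ⟨hzA, hzB⟩, ⟨hz1, hz2⟩, hzS⟩ : ∃ z ∈ A ×ˢ B, (z.1 ∈ U ∧ z.2 ∈ U) ∧
        ∀ S : Finset ι, S.piecewise z.1 z.2 ∉ N₃ ∧ S.piecewise z.1 z.2 ∉ N₄ := by
      by_contra hne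
      push Not at hne
      apply hAB
      refine measure_mono_null (fun z hz => ?_) (ae_iff.1 good)
      intro h
      obtain ⟨S, hS⟩ := hne z hz h.1
      exact (h.2 S).2 (hS (h.2 S).1)
    have hu : ∀ i, z.1 i ∈ Icc (0 : ℝ) 1 := fun i => Ioo_subset_Icc_self (Set.mem_univ_pi.1 hz1 i)
    have hv : ∀ i, z.2 i ∈ Icc (0 : ℝ) 1 := fun i => Ioo_subset_Icc_self (Set.mem_univ_pi.1 hz2 i)
    -- the two gluings realising the meet and the join
    set S₃ : Finset ι := Finset.univ.filter fun i => x i < y i ∨ (x i = y i ∧ z.1 i ≤ z.2 i) with hS₃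
    set S₄ : Finset ι := Finset.univ.filter fun i => y i < x i ∨ (x i = y i ∧ z.2 i ≤ z.1 i) with hS₄
    have hinf : θ x z.1 ⊓ θ y z.2 = θ (x ⊓ y) (S₃.piecewise z.1 z.2) :=
      rpit_pi_inf ν x y hu hv S₃ fun i => by simp [hS₃]
    have hsup : θ x z.1 ⊔ θ y z.2 = θ (x ⊔ y) (S₄.piecewise z.1 z.2) :=
      rpit_pi_sup ν x y hu hv S₄ fun i => by simp [hS₄]
    have hpU : ∀ S : Finset ι, S.piecewise z.1 z.2 ∈ U := fun S => Set.mem_univ_pi.2 fun i => by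
      by_cases hi : i ∈ S
      · rw [Finset.piecewise_eq_of_mem _ _ _ hi]; exact Set.mem_univ_pi.1 hz1 i
      · rw [Finset.piecewise_eq_of_notMem _ _ _ hi]; exact Set.mem_univ_pi.1 hz2 i
    have hg3 : F' (θ (x ⊓ y) (S₃.piecewise z.1 z.2)) ≤ F (x ⊓ y) := by
      by_contra hlt
      exact (hzS S₃).1 ⟨not_le.1 hlt, hpU S₃⟩
    have hg4 : F' (θ (x ⊔ y) (S₄.piecewise z.1 z.2)) ≤ F (x ⊔ y) := by
      by_contra hlt
      exact (hzS S₄).2 ⟨not_le.1 hlt, hpU S₄⟩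
    calc a * b ≤ F' (θ x z.1) * F' (θ y z.2) := mul_le_mul' hzA.le hzB.le
      _ ≤ F' (θ x z.1 ⊓ θ y z.2) * F' (θ x z.1 ⊔ θ y z.2) := hF'mtp _ _
      _ = F' (θ (x ⊓ y) (S₃.piecewise z.1 z.2)) * F' (θ (x ⊔ y) (S₄.piecewise z.1 z.2)) := by rw [hinf, hsup]
      _ ≤ F (x ⊓ y) * F (x ⊔ y) := mul_le_mul' hg3 hg4


/-- **Lebesgue on `ℝ^ι` ⟹ every finite product of σ-finite measures on `ℝ` (atoms allowed).** [this work] -/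
theorem HasBorelMTP2Versions.pi_of_volume' (hP : HasBorelMTP2Versions (volume : Measure (ι → ℝ)))
    (ρ : ι → Measure ℝ) [∀ i, SigmaFinite (ρ i)] : HasBorelMTP2Versions (Measure.pi ρ) := by
  by_cases h0 : ∃ i, ρ i = 0
  · obtain ⟨i, hi⟩ := h0
    have hpi : Measure.pi ρ = 0 := by
      rw [← Measure.measure_univ_eq_zero, Measure.pi_univ]
      exact Finset.prod_eq_zero (Finset.mem_univ i) (by rw [hi]; rfl)
    rw [hpi]
    exact hasBorelMTP2Versions_zero
  · push Not at h0
    haveI : ∀ i, NeZero (ρ i) := fun i => ⟨h0 i⟩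
    set ν : ι → Measure ℝ := fun i => (ρ i).toFinite with hν
    haveI : ∀ i, IsProbabilityMeasure (ν i) := fun i => by rw [hν]; infer_instance
    have hPν : HasBorelMTP2Versions (Measure.pi ν) := (hP.restrict_openUnitCube).pi_of_restrict_openUnitCube' ν
    exact hPν.of_equivalent (pi_absolutelyContinuous_pi_toFinite ρ) (pi_toFinite_absolutelyContinuous_pi ρ)

/-- **Unfolded form.**  Granted the Borel-version property of Lebesgue measure on `ℝ^ι` (R5), for every finite family
of σ-finite measures `ρᵢ` on `ℝ` (atoms allowed), every measurable `f : ℝ^ι → [c, M]` (`0 < c`, `M < ∞`) which is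
MTP₂ on `(⊗ρᵢ) ⊗ (⊗ρᵢ)`-almost every pair has a bounded measurable version `F = f` a.e. with
`F(x) F(y) ≤ F(x ∧ y) F(x ∨ y)` for ALL `x, y`. [this work] -/
theorem exists_measurable_mtp2_version_of_ae_pi_of_volume'
    (hP : HasBorelMTP2Versions (volume : Measure (ι → ℝ))) (ρ : ι → Measure ℝ) [∀ i, SigmaFinite (ρ i)]
    (f : (ι → ℝ) → ℝ≥0∞) (hf : Measurable f) {c M : ℝ≥0∞} (hc : c ≠ 0) (hM : M ≠ ∞)
    (hcf : ∀ x, c ≤ f x) (hfM : ∀ x, f x ≤ M)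
    (hMTP : ∀ᵐ p ∂(Measure.pi ρ).prod (Measure.pi ρ), f p.1 * f p.2 ≤ f (p.1 ⊓ p.2) * f (p.1 ⊔ p.2)) :
    ∃ F : (ι → ℝ) → ℝ≥0∞, Measurable F ∧ (∃ M' : ℝ≥0∞, M' ≠ ∞ ∧ ∀ x, F x ≤ M') ∧ F =ᵐ[Measure.pi ρ] f ∧
      ∀ x y, F x * F y ≤ F (x ⊓ y) * F (x ⊔ y) :=
  hP.pi_of_volume' ρ f hf c M hc hM hcf hfM hMTP

end Atoms

end Summit.CriticalPhenomena.PercolationContinuityZ3.Theorems.SahiAEFourFunctions
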